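import Literature.Analysis.FluidPDE.TorusNSGevreySums
import HarnessLib

/-!
# The Foias–Temam Gevrey balance on the lattice: the differential inequality

Analysis/FluidPDE support file (theorems only), fourth of the files proving the Gevrey-class
smoothing estimate of Foias–Temam (J. Funct. Anal. 87 (1989), Thm 1.1 / Lemma 2.1) for classical
solutions of the Navier–Stokes system on `T^d`, `card d ≤ 3`. Here is the heart of the matter,
the **differential inequality for the truncated Gevrey enstrophy**, first as a pure lattice
inequality and then for the slices of a classical solution.

With `x_k = |k|²`, truncated weights `e_k = exp(ψ min(|k|, N))` (`0 ≤ ψ ≤ σ`), a nonnegative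
family `a` (the sizes `‖û(k)‖` of the modes of a zero-mean field, `a 0 = 0`) with
`∑ x_k² a_k² < ∞`, the partial Gevrey sums `Y_R = ∑_{ball R} e² x a²`, `Z_R = ∑_{ball R} e² x² a²`
and the full sums `Y`, `Z`, the lattice theorem `exists_latticeBalance_bound` says: for every
level `Λ` there is `G = G(d, κ, C, Λ, F)` such that whenever `Y ≤ Λ`,
`∑_{ball R} (2 min(|k|,N) e² x a² + e² x · 2(−κ x a² − r + s)) ≤ −(5/4) κ Z_R + (κ/4) Z + G`,
where `|r_k| ≤ b_k a_k`, `b_k ≤ C ∑ₘ aₘ |k−m| a_{k−m}` (the convective term, a lattice convolution)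
and `|s_k| ≤ c_k a_k`, `∑_{ball R} e^{2σ|k|} x c² ≤ F` (an analytic force). The three estimates:
the weight derivative `2|k| x ≤ (κ/2) x² + (2/κ) x`; the force by Cauchy–Schwarz; the trilinear
term by the submultiplicativity `e_k ≤ e_m e_{k−m}`, the Young/Cauchy–Schwarz lattice inequality
`NSGevrey.sum_mul_tsum_mul_le` and the `ℓ¹` splitting `NSGevrey.tsum_le_sqrt_card_mul_sqrt_add` at
a ball `ρ = ρ(κ, C, Λ)` so large that the tail coefficient is absorbed by `κ/4` (in place of
Foias–Temam's optimised lattice Agmon inequality).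

`IsClassicalNSSolutionOn.exists_gevreyBalance_bound` instantiates this along a classical solution
on `[t₀, t₁] × T^d` with zero-mean slices and an analytic (e.g. trigonometric-polynomial) force:
the time derivative of `Y_R(t)` (`NSGevrey.hasDerivWithinAt_sum_exp_sq_mul_freqNormSq_mul`,
`ψ = t − t₀`) is at most `−(5/4)κ Z_R(t) + (κ/4) Z(t) + G` whenever `Y(t) ≤ Λ` (`κ = 4π²ν`),
uniformly in `N`, `R`, the window and the solution. Integration in time, `R → ∞` and the bootstrap
are in `TorusNSGevreyBootstrap`. Tree search: no Gevrey-class / analyticity-radius estimate for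
Navier–Stokes existed (`lean search 'Gevrey|FoiasTemam'`; `NSLocalAnalyticityRadius*` is a
different, local-in-space statement).

Reference: C. Foias, R. Temam, *Gevrey class regularity for the solutions of the Navier–Stokes
equations*, J. Funct. Anal. 87 (1989) 359–369, Thm 1.1, Lemma 2.1, (2.7)–(2.15). [FoiasTemam1989]
-/

noncomputable section

open MeasureTheory Set Filter UnitAddTorus Function Finset
open scoped Topology BigOperators InnerProductSpace

namespace Literature.Analysis.FluidPDE

namespace NSGevrey

open Literature.Analysis.FunctionSpaces Literature.Analysis.FunctionSpaces.Torus

variable {d : Type*} [Fintype d] [DecidableEq d]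

/-! ### Elementary inequalities -/

section Elementary

omit [DecidableEq d] in
/-- The weight-derivative term is absorbed: `2 min(|k|,N) |k|² ≤ (κ/2)|k|⁴ + (2/κ)|k|²` for `κ > 0`
(`4κ s³ ≤ κ² s⁴ + 4 s²` with `s = |k|`). [folklore] -/
theorem two_mul_min_mul_freqNormSq_le {κ : ℝ} (hκ : 0 < κ) (N : ℝ) (k : d → ℤ) :
    2 * min (Real.sqrt (freqNormSq k)) N * freqNormSq k ≤
      κ / 2 * freqNormSq k ^ 2 + 2 / κ * freqNormSq k := by
  set s : ℝ := Real.sqrt (freqNormSq k) with hs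
  rw [show freqNormSq k = s ^ 2 from (Real.sq_sqrt (freqNormSq_nonneg k)).symm]
  have h1 : 2 * min s N * s ^ 2 ≤ 2 * s * s ^ 2 :=
    mul_le_mul_of_nonneg_right (mul_le_mul_of_nonneg_left (min_le_left _ _) (by norm_num)) (sq_nonneg _)
  refine h1.trans ?_
  have key : κ / 2 * (s ^ 2) ^ 2 + 2 / κ * s ^ 2 - 2 * s * s ^ 2 = (s ^ 2 * (κ * s - 2) ^ 2) / (2 * κ) := by
    field_simp
    ring
  linarith [show 0 ≤ (s ^ 2 * (κ * s - 2) ^ 2) / (2 * κ) by positivity]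

/-- Young's inequality in the form `2AB ≤ (κ/4) B² + (4/κ) A²` (`κ > 0`). [folklore] -/
theorem two_mul_le_quarter_add {κ : ℝ} (hκ : 0 < κ) (A B : ℝ) :
    2 * A * B ≤ κ / 4 * B ^ 2 + 4 / κ * A ^ 2 := by
  have key : κ / 4 * B ^ 2 + 4 / κ * A ^ 2 - 2 * A * B = (4 / κ) * (κ / 4 * B - A) ^ 2 := by
    field_simp
    ring
  linarith [show 0 ≤ (4 / κ) * (κ / 4 * B - A) ^ 2 by positivity]

end Elementary

/-! ### The lattice form of the Gevrey balance -/

section Lattice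

/-- **The Foias–Temam Gevrey balance on the lattice** (truncated weights, one differential
inequality at a fixed time, everything explicit). Let `card d ≤ 3`, `κ > 0`, `C, Λ, F ≥ 0`. There is
`G ≥ 0` such that for every nonnegative family `a` on `ℤ^d` with `a 0 = 0` and `∑ |k|⁴ a_k² < ∞`,
all `0 ≤ ψ ≤ σ`, `N ≥ 0`, `R`, all families `b, c, r, s` with `b_k ≤ C ∑ₘ aₘ |k−m| a_{k−m}`,
`|r_k| ≤ b_k a_k`, `|s_k| ≤ c_k a_k`, `∑_{ball R} e^{2σ|k|} |k|² c_k² ≤ F`, and with the truncated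
weights `e_k = exp(ψ min(|k|,N))`: if `∑ₖ e_k² |k|² a_k² ≤ Λ` then
`∑_{k ∈ ball R} (2 min(|k|,N) e_k²|k|²a_k² + e_k²|k|² · 2(−κ|k|²a_k² − r_k + s_k))`
`≤ −(5/4)κ ∑_{ball R} e_k²|k|⁴a_k² + (κ/4) ∑ₖ e_k²|k|⁴a_k² + G`.
This is (2.7)–(2.15) of Foias–Temam with the optimised lattice Agmon inequality replaced by the
`ℓ¹` splitting at a large ball. [cite: FoiasTemam1989, Lemma 2.1 and (2.7)–(2.15)] -/
theorem exists_latticeBalance_bound [Nonempty d] (hd : Fintype.card d ≤ 3) {κ C Λ F : ℝ}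
    (hκ : 0 < κ) (hC : 0 ≤ C) (hΛ : 0 ≤ Λ) (hF : 0 ≤ F) :
    ∃ G : ℝ, 0 ≤ G ∧ ∀ {a b c r s : (d → ℤ) → ℝ} {ψ σ N : ℝ} (R : ℕ),
      (∀ k, 0 ≤ a k) → a 0 = 0 → (Summable fun k => freqNormSq k ^ 2 * a k ^ 2) →
      0 ≤ ψ → ψ ≤ σ → 0 ≤ N →
      (∀ k, b k ≤ C * ∑' m, a m * (Real.sqrt (freqNormSq (k - m)) * a (k - m))) →
      (∀ k, |r k| ≤ b k * a k) → (∀ k, |s k| ≤ c k * a k) →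
      (∑ k ∈ freqBall R, Real.exp (σ * Real.sqrt (freqNormSq k)) ^ 2 * (freqNormSq k * c k ^ 2) ≤ F) →
      (∑' k, Real.exp (ψ * min (Real.sqrt (freqNormSq k)) N) ^ 2 * (freqNormSq k * a k ^ 2) ≤ Λ) →
      ∑ k ∈ freqBall R, (2 * min (Real.sqrt (freqNormSq k)) N *
            Real.exp (ψ * min (Real.sqrt (freqNormSq k)) N) ^ 2 * (freqNormSq k * a k ^ 2) +
          Real.exp (ψ * min (Real.sqrt (freqNormSq k)) N) ^ 2 *
            (freqNormSq k * (2 * (-(κ * freqNormSq k) * a k ^ 2 - r k + s k)))) ≤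
        -(5 / 4 * κ) * ∑ k ∈ freqBall R, Real.exp (ψ * min (Real.sqrt (freqNormSq k)) N) ^ 2 *
            (freqNormSq k ^ 2 * a k ^ 2) +
          κ / 4 * ∑' k, Real.exp (ψ * min (Real.sqrt (freqNormSq k)) N) ^ 2 *
            (freqNormSq k ^ 2 * a k ^ 2) + G := by
  -- choice of the splitting ball `ρ`: tail coefficient `η_ρ < ε`
  set ε : ℝ := (κ / (8 * (C + 1))) ^ 2 / (Λ + 1) with hε
  have hC1 : 0 < C + 1 := by linarith
  have hΛ1 : 0 < Λ + 1 := by linarith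
  have hε0 : 0 < ε := by positivity
  obtain ⟨ρ, hρ⟩ : ∃ ρ : ℕ, ∑' k : {k // k ∉ freqBall (d := d) ρ}, (freqNormSq (k : d → ℤ) ^ 2)⁻¹ < ε :=
    ((tendsto_order.1 (tendsto_tsum_compl_freqBall_inv_freqNormSq_sq (d := d))).2 ε hε0).exists
  set η : ℝ := ∑' k : {k // k ∉ freqBall (d := d) ρ}, (freqNormSq (k : d → ℤ) ^ 2)⁻¹ with hη
  have hη0 : 0 ≤ η := tsum_nonneg fun k => by positivity
  set L : ℝ := Real.sqrt ((freqBall (d := d) ρ).card) with hL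
  have hL0 : 0 ≤ L := Real.sqrt_nonneg _
  -- the constant
  refine ⟨(2 / κ + 1) * Λ + 4 / κ * (C * L * Λ) ^ 2 + F, by positivity, ?_⟩
  intro a b c r s ψ σ N R ha0 ha00 hZs hψ hψσ hN hb hr hs hcF hYΛ
  -- the weights
  set e : (d → ℤ) → ℝ := fun k => Real.exp (ψ * min (Real.sqrt (freqNormSq k)) N) with he
  have he0 : ∀ k, 0 < e k := fun k => Real.exp_pos _
  have he1 : ∀ k, 1 ≤ e k := fun k =>
    Real.one_le_exp (mul_nonneg hψ (le_min (Real.sqrt_nonneg _) hN))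
  set W : ℝ := Real.exp (ψ * N) ^ 2 with hW
  have heW : ∀ k, e k ^ 2 ≤ W := fun k =>
    pow_le_pow_left₀ (he0 k).le (exp_mul_min_le_exp_mul hψ k) 2
  have hsub : ∀ k m, e k ≤ e m * e (k - m) := fun k m => exp_mul_min_le_mul hψ hN k m
  -- summability of the weighted moments
  have hx0 : ∀ k : d → ℤ, 0 ≤ freqNormSq k := fun k => freqNormSq_nonneg k
  have hZw : Summable fun k => e k ^ 2 * (freqNormSq k ^ 2 * a k ^ 2) :=
    (hZs.mul_left W).of_nonneg_of_le (fun k => by positivity) fun k =>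
      mul_le_mul_of_nonneg_right (heW k) (by positivity)
  have hYw : Summable fun k => e k ^ 2 * (freqNormSq k * a k ^ 2) :=
    hZw.of_nonneg_of_le (fun k => mul_nonneg (sq_nonneg _) (mul_nonneg (hx0 k) (sq_nonneg _))) fun k =>
      mul_le_mul_of_nonneg_left (mul_le_mul_of_nonneg_right (freqNormSq_le_freqNormSq_sq k) (sq_nonneg _))
        (sq_nonneg _)
  set Y : ℝ := ∑' k, e k ^ 2 * (freqNormSq k * a k ^ 2) with hY
  set Z : ℝ := ∑' k, e k ^ 2 * (freqNormSq k ^ 2 * a k ^ 2) with hZ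
  set YR : ℝ := ∑ k ∈ freqBall R, e k ^ 2 * (freqNormSq k * a k ^ 2) with hYR
  set ZR : ℝ := ∑ k ∈ freqBall R, e k ^ 2 * (freqNormSq k ^ 2 * a k ^ 2) with hZR
  have hy0 : ∀ k, 0 ≤ e k ^ 2 * (freqNormSq k * a k ^ 2) := fun k =>
    mul_nonneg (sq_nonneg _) (mul_nonneg (hx0 k) (sq_nonneg _))
  have hY0 : 0 ≤ Y := tsum_nonneg hy0
  have hZ0 : 0 ≤ Z := tsum_nonneg fun k => by positivity
  have hZR0 : 0 ≤ ZR := Finset.sum_nonneg fun k _ => by positivity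
  have hYRY : YR ≤ Y := sum_freqBall_le_tsum hy0 hYw R
  have hZRZ : ZR ≤ Z := sum_freqBall_le_tsum (fun k => by positivity) hZw R
  have hYΛ' : Y ≤ Λ := hYΛ
  -- the three auxiliary families
  set α : (d → ℤ) → ℝ := fun k => e k * a k with hα
  set β : (d → ℤ) → ℝ := fun k => e k * (Real.sqrt (freqNormSq k) * a k) with hβ
  set γ : (d → ℤ) → ℝ := fun k => freqNormSq k * (e k * a k) with hγ
  have hα0 : ∀ k, 0 ≤ α k := fun k => mul_nonneg (he0 k).le (ha0 k)
  have hβ0 : ∀ k, 0 ≤ β k := fun k => mul_nonneg (he0 k).le (mul_nonneg (Real.sqrt_nonneg _) (ha0 k))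
  have hγ0 : ∀ k, 0 ≤ γ k := fun k => mul_nonneg (hx0 k) (hα0 k)
  have hβ2 : ∀ k, β k ^ 2 = e k ^ 2 * (freqNormSq k * a k ^ 2) := fun k => by
    simp only [hβ, mul_pow, Real.sq_sqrt (hx0 k)]
  have hγ2 : ∀ k, γ k ^ 2 = e k ^ 2 * (freqNormSq k ^ 2 * a k ^ 2) := fun k => by simp only [hγ]; ring
  have hxα2 : ∀ k, freqNormSq k * α k ^ 2 = e k ^ 2 * (freqNormSq k * a k ^ 2) := fun k => by
    simp only [hα]; ring
  have hx2α2 : ∀ k, freqNormSq k ^ 2 * α k ^ 2 = e k ^ 2 * (freqNormSq k ^ 2 * a k ^ 2) := fun k => by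
    simp only [hα]; ring
  have hβs : Summable fun k => β k ^ 2 := hYw.congr fun k => (hβ2 k).symm
  have hβY : ∑' k, β k ^ 2 = Y := tsum_congr hβ2
  -- `ℓ¹` splitting of `α`
  have hsplit := tsum_le_sqrt_card_mul_sqrt_add hd hα0 (by simp only [hα, ha00, mul_zero])
    (hYw.congr fun k => (hxα2 k).symm) (hZw.congr fun k => (hx2α2 k).symm) ρ
  have hαs : Summable α := hsplit.1
  have hα1 : ∑' k, α k ≤ L * Real.sqrt Y + Real.sqrt η * Real.sqrt Z := by
    have h := hsplit.2
    rwa [tsum_congr hxα2, tsum_congr hx2α2] at h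
  -- the convolution bound with the weights distributed: `e_k · (C ∑ₘ aₘ |k-m| a_{k-m}) ≤ C ∑ₘ αₘ β_{k-m}`
  have hβle : ∀ k, β k ≤ Real.sqrt Y := fun k => hβY ▸ le_sqrt_tsum_sq hβ0 hβs k
  have hαβs : ∀ k, Summable fun m => α m * β (k - m) := fun k =>
    (hαs.mul_right (Real.sqrt Y)).of_nonneg_of_le (fun m => mul_nonneg (hα0 m) (hβ0 _)) fun m =>
      mul_le_mul_of_nonneg_left (hβle _) (hα0 m)
  have hconv : ∀ k, e k * (C * ∑' m, a m * (Real.sqrt (freqNormSq (k - m)) * a (k - m))) ≤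
      C * ∑' m, α m * β (k - m) := by
    intro k
    have hterm : ∀ m, e k * (a m * (Real.sqrt (freqNormSq (k - m)) * a (k - m))) ≤ α m * β (k - m) := by
      intro m
      have hq : 0 ≤ a m * (Real.sqrt (freqNormSq (k - m)) * a (k - m)) :=
        mul_nonneg (ha0 m) (mul_nonneg (Real.sqrt_nonneg _) (ha0 _))
      calc e k * (a m * (Real.sqrt (freqNormSq (k - m)) * a (k - m)))
          ≤ (e m * e (k - m)) * (a m * (Real.sqrt (freqNormSq (k - m)) * a (k - m))) := mul_le_mul_of_nonneg_right (hsub k m) hq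
        _ = α m * β (k - m) := by simp only [hα, hβ]; ring
    have hs1 : Summable fun m => e k * (a m * (Real.sqrt (freqNormSq (k - m)) * a (k - m))) :=
      (hαβs k).of_nonneg_of_le (fun m => mul_nonneg (he0 k).le (mul_nonneg (ha0 m)
        (mul_nonneg (Real.sqrt_nonneg _) (ha0 _)))) hterm
    rw [mul_left_comm, ← tsum_mul_left]
    exact mul_le_mul_of_nonneg_left (hs1.tsum_le_tsum hterm (hαβs k)) hC
  -- termwise bounds for the four pieces
  have h1 : ∀ k, 2 * min (Real.sqrt (freqNormSq k)) N * e k ^ 2 * (freqNormSq k * a k ^ 2) ≤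
      κ / 2 * (e k ^ 2 * (freqNormSq k ^ 2 * a k ^ 2)) + 2 / κ * (e k ^ 2 * (freqNormSq k * a k ^ 2)) := by
    intro k
    have h := two_mul_min_mul_freqNormSq_le hκ N k
    have hw : 0 ≤ e k ^ 2 * a k ^ 2 := by positivity
    calc 2 * min (Real.sqrt (freqNormSq k)) N * e k ^ 2 * (freqNormSq k * a k ^ 2)
        = (2 * min (Real.sqrt (freqNormSq k)) N * freqNormSq k) * (e k ^ 2 * a k ^ 2) := by ring
      _ ≤ (κ / 2 * freqNormSq k ^ 2 + 2 / κ * freqNormSq k) * (e k ^ 2 * a k ^ 2) :=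
          mul_le_mul_of_nonneg_right h hw
      _ = _ := by ring
  have h3 : ∀ k, e k ^ 2 * (freqNormSq k * (2 * -r k)) ≤ 2 * C * (γ k * ∑' m, α m * β (k - m)) := by
    intro k
    have hrk : -r k ≤ b k * a k := (neg_le_abs (r k)).trans (hr k)
    have hba : b k * a k ≤ (C * ∑' m, a m * (Real.sqrt (freqNormSq (k - m)) * a (k - m))) * a k :=
      mul_le_mul_of_nonneg_right (hb k) (ha0 k)
    have hw : 0 ≤ e k ^ 2 * freqNormSq k * 2 := mul_nonneg (mul_nonneg (sq_nonneg _) (hx0 k)) (by norm_num)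
    calc e k ^ 2 * (freqNormSq k * (2 * -r k)) = (e k ^ 2 * freqNormSq k * 2) * (-r k) := by ring
      _ ≤ (e k ^ 2 * freqNormSq k * 2) *
          ((C * ∑' m, a m * (Real.sqrt (freqNormSq (k - m)) * a (k - m))) * a k) :=
          mul_le_mul_of_nonneg_left (hrk.trans hba) hw
      _ = 2 * (γ k * (e k * (C * ∑' m, a m * (Real.sqrt (freqNormSq (k - m)) * a (k - m))))) := by
          simp only [hγ]; ring
      _ ≤ 2 * (γ k * (C * ∑' m, α m * β (k - m))) :=
          mul_le_mul_of_nonneg_left (mul_le_mul_of_nonneg_left (hconv k) (hγ0 k)) (by norm_num)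
      _ = 2 * C * (γ k * ∑' m, α m * β (k - m)) := by ring
  have h4 : ∀ k ∈ freqBall R, e k ^ 2 * (freqNormSq k * (2 * s k)) ≤
      Real.exp (σ * Real.sqrt (freqNormSq k)) ^ 2 * (freqNormSq k * c k ^ 2) +
        e k ^ 2 * (freqNormSq k * a k ^ 2) := by
    intro k _
    have hsk : 2 * s k ≤ c k ^ 2 + a k ^ 2 := by
      have h' : s k ≤ c k * a k := (le_abs_self _).trans (hs k)
      nlinarith [sq_nonneg (c k - a k)]
    have heσ : e k ^ 2 ≤ Real.exp (σ * Real.sqrt (freqNormSq k)) ^ 2 := by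
      refine pow_le_pow_left₀ (he0 k).le (Real.exp_le_exp.2 ?_) 2
      exact mul_le_mul hψσ (min_le_left _ _) (le_min (Real.sqrt_nonneg _) hN) ((hψ.trans hψσ))
    have hw : 0 ≤ e k ^ 2 * freqNormSq k := mul_nonneg (sq_nonneg _) (hx0 k)
    calc e k ^ 2 * (freqNormSq k * (2 * s k)) = (e k ^ 2 * freqNormSq k) * (2 * s k) := by ring
      _ ≤ (e k ^ 2 * freqNormSq k) * (c k ^ 2 + a k ^ 2) := mul_le_mul_of_nonneg_left hsk hw
      _ = e k ^ 2 * (freqNormSq k * c k ^ 2) + e k ^ 2 * (freqNormSq k * a k ^ 2) := by ring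
      _ ≤ _ := add_le_add (mul_le_mul_of_nonneg_right heσ (mul_nonneg (hx0 k) (sq_nonneg _))) le_rfl
  -- the trilinear sum
  have htri : ∑ k ∈ freqBall R, 2 * C * (γ k * ∑' m, α m * β (k - m)) ≤
      κ / 4 * ZR + 4 / κ * (C * L * Λ) ^ 2 + κ / 4 * Z := by
    rw [← Finset.mul_sum]
    have hcore := sum_mul_tsum_mul_le (freqBall R) hα0 hβ0 hγ0 hαs hβs
    have hγZR : ∑ k ∈ freqBall R, γ k ^ 2 = ZR := Finset.sum_congr rfl fun k _ => hγ2 k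
    rw [hβY, hγZR] at hcore
    have h2C : 0 ≤ 2 * C := by positivity
    have hsY : Real.sqrt Y ≤ Real.sqrt Λ := Real.sqrt_le_sqrt hYΛ'
    have hsZR : Real.sqrt ZR ≤ Real.sqrt Z := Real.sqrt_le_sqrt hZRZ
    -- `2C ‖α‖₁ √Y √Z_R ≤ 2C (L√Y + √η√Z) √Y √Z_R ≤ 2 C L Λ √Z_R + 2 C √η √Λ Z`
    have hstep : 2 * C * ((∑' k, α k) * Real.sqrt Y * Real.sqrt ZR) ≤
        2 * (C * L * Λ) * Real.sqrt ZR + (2 * C * Real.sqrt η * Real.sqrt Λ) * Z := by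
      have hYY : Real.sqrt Y * Real.sqrt Y = Y := Real.mul_self_sqrt hY0
      have hZZ : Real.sqrt Z * Real.sqrt Z = Z := Real.mul_self_sqrt hZ0
      calc 2 * C * ((∑' k, α k) * Real.sqrt Y * Real.sqrt ZR)
          ≤ 2 * C * ((L * Real.sqrt Y + Real.sqrt η * Real.sqrt Z) * Real.sqrt Y * Real.sqrt ZR) := by
            gcongr
        _ = 2 * C * L * (Real.sqrt Y * Real.sqrt Y) * Real.sqrt ZR +
            2 * C * Real.sqrt η * Real.sqrt Y * (Real.sqrt Z * Real.sqrt ZR) := by ring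
        _ ≤ 2 * C * L * Λ * Real.sqrt ZR + 2 * C * Real.sqrt η * Real.sqrt Λ * (Real.sqrt Z * Real.sqrt Z) := by
            rw [hYY]
            refine add_le_add ?_ ?_
            · exact mul_le_mul_of_nonneg_right (mul_le_mul_of_nonneg_left hYΛ' (by positivity))
                (Real.sqrt_nonneg _)
            · exact mul_le_mul (mul_le_mul_of_nonneg_left hsY (by positivity))
                (mul_le_mul_of_nonneg_left hsZR (Real.sqrt_nonneg _)) (by positivity) (by positivity)
        _ = 2 * (C * L * Λ) * Real.sqrt ZR + (2 * C * Real.sqrt η * Real.sqrt Λ) * Z := by rw [hZZ]; ring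
    -- the tail coefficient is small by the choice of `ρ`
    have hsmall : 2 * C * Real.sqrt η * Real.sqrt Λ ≤ κ / 4 := by
      have hηε : Real.sqrt η ≤ Real.sqrt ε := Real.sqrt_le_sqrt hρ.le
      have hΛε : Real.sqrt Λ ≤ Real.sqrt (Λ + 1) := Real.sqrt_le_sqrt (by linarith)
      have hprod : Real.sqrt ε * Real.sqrt (Λ + 1) = κ / (8 * (C + 1)) := by
        rw [← Real.sqrt_mul hε0.le, show ε * (Λ + 1) = (κ / (8 * (C + 1))) ^ 2 by
          rw [hε]; field_simp, Real.sqrt_sq (by positivity)]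
      calc 2 * C * Real.sqrt η * Real.sqrt Λ ≤ 2 * (C + 1) * Real.sqrt ε * Real.sqrt (Λ + 1) := by
            have : 2 * C ≤ 2 * (C + 1) := by linarith
            exact mul_le_mul (mul_le_mul this hηε (Real.sqrt_nonneg _) (by positivity)) hΛε
              (Real.sqrt_nonneg _) (by positivity)
        _ = 2 * (C + 1) * (Real.sqrt ε * Real.sqrt (Λ + 1)) := by ring
        _ = κ / 4 := by rw [hprod]; field_simp; ring
    have hyoung : 2 * (C * L * Λ) * Real.sqrt ZR ≤ κ / 4 * ZR + 4 / κ * (C * L * Λ) ^ 2 := by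
      have h := two_mul_le_quarter_add hκ (C * L * Λ) (Real.sqrt ZR)
      rwa [Real.sq_sqrt hZR0] at h
    calc 2 * C * ∑ k ∈ freqBall R, γ k * ∑' m, α m * β (k - m)
        ≤ 2 * C * ((∑' k, α k) * Real.sqrt Y * Real.sqrt ZR) := mul_le_mul_of_nonneg_left hcore h2C
      _ ≤ 2 * (C * L * Λ) * Real.sqrt ZR + (2 * C * Real.sqrt η * Real.sqrt Λ) * Z := hstep
      _ ≤ (κ / 4 * ZR + 4 / κ * (C * L * Λ) ^ 2) + κ / 4 * Z :=
          add_le_add hyoung (mul_le_mul_of_nonneg_right hsmall hZ0)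
      _ = _ := by ring
  -- assemble
  have hsplit4 : ∀ k, 2 * min (Real.sqrt (freqNormSq k)) N * e k ^ 2 * (freqNormSq k * a k ^ 2) +
      e k ^ 2 * (freqNormSq k * (2 * (-(κ * freqNormSq k) * a k ^ 2 - r k + s k))) =
      2 * min (Real.sqrt (freqNormSq k)) N * e k ^ 2 * (freqNormSq k * a k ^ 2) +
        (-(2 * κ) * (e k ^ 2 * (freqNormSq k ^ 2 * a k ^ 2))) +
        e k ^ 2 * (freqNormSq k * (2 * -r k)) + e k ^ 2 * (freqNormSq k * (2 * s k)) := fun k => by ring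
  rw [Finset.sum_congr rfl fun k _ => hsplit4 k, Finset.sum_add_distrib, Finset.sum_add_distrib,
    Finset.sum_add_distrib]
  have hS1 : ∑ k ∈ freqBall R, 2 * min (Real.sqrt (freqNormSq k)) N * e k ^ 2 * (freqNormSq k * a k ^ 2) ≤
      κ / 2 * ZR + 2 / κ * YR := by
    rw [hZR, hYR, Finset.mul_sum, Finset.mul_sum, ← Finset.sum_add_distrib]
    exact Finset.sum_le_sum fun k _ => h1 k
  have hS2 : ∑ k ∈ freqBall R, -(2 * κ) * (e k ^ 2 * (freqNormSq k ^ 2 * a k ^ 2)) = -(2 * κ) * ZR := by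
    rw [hZR, Finset.mul_sum]
  have hS3 : ∑ k ∈ freqBall R, e k ^ 2 * (freqNormSq k * (2 * -r k)) ≤
      κ / 4 * ZR + 4 / κ * (C * L * Λ) ^ 2 + κ / 4 * Z :=
    (Finset.sum_le_sum fun k _ => h3 k).trans htri
  have hS4 : ∑ k ∈ freqBall R, e k ^ 2 * (freqNormSq k * (2 * s k)) ≤ F + YR := by
    refine (Finset.sum_le_sum h4).trans ?_
    rw [Finset.sum_add_distrib]
    exact add_le_add hcF le_rfl
  have hYRΛ : YR ≤ Λ := hYRY.trans hYΛ'
  have hκ2 : 0 ≤ 2 / κ + 1 := by positivity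
  have hlast : (2 / κ + 1) * YR ≤ (2 / κ + 1) * Λ := mul_le_mul_of_nonneg_left hYRΛ hκ2
  rw [hS2]
  linarith [hS1, hS3, hS4, hlast, hZR0]

end Lattice

/-! ### The balance along a classical solution -/

section Solution

omit [DecidableEq d] in
/-- The zero mode of a complexified mean-zero integrable real field vanishes. [folklore] -/
theorem mFourierCoeff_complexify_zero_of_hasZeroMean {v : UnitAddTorus d → EuclideanSpace ℝ d}
    (hv : Integrable v volume) (h0 : HasZeroMean v) :
    mFourierCoeff (EuclideanSpace.complexify ∘ v) 0 = 0 := by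
  rw [mFourierCoeff_eq_integral_volume]
  simp only [neg_zero, mFourier_zero, ContinuousMap.one_apply, one_smul, Function.comp_apply]
  unfold HasZeroMean at h0
  have h := (EuclideanSpace.complexify (ι := d)).toContinuousLinearMap.integral_comp_comm hv
  rw [h0, map_zero] at h
  exact h

variable {ν : ℝ} {t₀ t₁ : ℝ} {f u : ℝ → UnitAddTorus d → EuclideanSpace ℝ d} {p : ℝ → UnitAddTorus d → ℝ}

/-- **The Foias–Temam Gevrey balance along a classical Navier–Stokes solution** (the
differential inequality, truncated weights `e_k(t) = exp((t − t₀) min(|k|, N))`, `κ = 4π²ν`).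
Let `card d ≤ 3`, `ν > 0`, `Λ, F ≥ 0`. There is `G ≥ 0` such that for every classical solution
`(u, p)` with force `f` on `[t₀, t₁] × T^d`, `t₀ < t₁`, with mean-zero slices and an analytic force,
`∑_{ball R} e^{2(t₁−t₀)|k|} |k|² ‖f̂(t,k)‖² ≤ F` for all `t, R`, and for all `N ≥ 0`, `R`, `t ∈ [t₀, t₁]`:
if the truncated Gevrey enstrophy `Y(t) = ∑ₖ e_k(t)² |k|² ‖û(t,k)‖²` is `≤ Λ`, then the time
derivative of its partial sum `Y_R` (`NSGevrey.hasDerivWithinAt_sum_exp_sq_mul_freqNormSq_mul`)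
is at most `−(5/4)κ Z_R(t) + (κ/4) Z(t) + G`, `Z = ∑ e_k² |k|⁴ ‖û‖²` (the lattice theorem via the
modewise energy identity and the convolution bound). [cite: FoiasTemam1989, Lemma 2.1 and (2.7)–(2.15)] -/
theorem _root_.Literature.Analysis.FunctionSpaces.Torus.IsClassicalNSSolutionOn.exists_gevreyBalance_bound
    [Nonempty d] (hd : Fintype.card d ≤ 3) (hν : 0 < ν) {Λ F : ℝ} (hΛ : 0 ≤ Λ) (hF : 0 ≤ F) :
    ∃ G : ℝ, 0 ≤ G ∧ ∀ {t₀ t₁ : ℝ} {f u : ℝ → UnitAddTorus d → EuclideanSpace ℝ d}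
      {p : ℝ → UnitAddTorus d → ℝ}, IsClassicalNSSolutionOn (Icc t₀ t₁) ν f u p → t₀ < t₁ →
      (∀ t ∈ Icc t₀ t₁, HasZeroMean (u t)) →
      (∀ t ∈ Icc t₀ t₁, ∀ R : ℕ, ∑ k ∈ freqBall R, Real.exp ((t₁ - t₀) * Real.sqrt (freqNormSq k)) ^ 2 *
        (freqNormSq k * ‖mFourierCoeff (EuclideanSpace.complexify ∘ f t) k‖ ^ 2) ≤ F) →
      ∀ {N : ℝ} (R : ℕ) {t : ℝ}, 0 ≤ N → t ∈ Icc t₀ t₁ →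
      (∑' k, Real.exp ((t - t₀) * min (Real.sqrt (freqNormSq k)) N) ^ 2 *
        (freqNormSq k * ‖mFourierCoeff (EuclideanSpace.complexify ∘ u t) k‖ ^ 2) ≤ Λ) →
      ∑ k ∈ freqBall R, (2 * min (Real.sqrt (freqNormSq k)) N *
            Real.exp ((t - t₀) * min (Real.sqrt (freqNormSq k)) N) ^ 2 *
              (freqNormSq k * ‖mFourierCoeff (EuclideanSpace.complexify ∘ u t) k‖ ^ 2) +
          Real.exp ((t - t₀) * min (Real.sqrt (freqNormSq k)) N) ^ 2 * (freqNormSq k *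
            (2 * (inner ℂ (mFourierCoeff (EuclideanSpace.complexify ∘ timeDerivWithin (Icc t₀ t₁) u t) k)
              (mFourierCoeff (EuclideanSpace.complexify ∘ u t) k)).re))) ≤
        -(5 / 4 * (4 * Real.pi ^ 2 * ν)) * ∑ k ∈ freqBall R,
            Real.exp ((t - t₀) * min (Real.sqrt (freqNormSq k)) N) ^ 2 *
              (freqNormSq k ^ 2 * ‖mFourierCoeff (EuclideanSpace.complexify ∘ u t) k‖ ^ 2) +
          4 * Real.pi ^ 2 * ν / 4 * ∑' k, Real.exp ((t - t₀) * min (Real.sqrt (freqNormSq k)) N) ^ 2 *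
              (freqNormSq k ^ 2 * ‖mFourierCoeff (EuclideanSpace.complexify ∘ u t) k‖ ^ 2) + G := by
  have hκ : 0 < 4 * Real.pi ^ 2 * ν := by positivity
  have hC : (0 : ℝ) ≤ 2 * Real.pi * (Fintype.card d : ℝ) ^ 2 := by positivity
  obtain ⟨G, hG0, hG⟩ := exists_latticeBalance_bound (d := d) hd hκ hC hΛ hF
  refine ⟨G, hG0, fun {t₀ t₁ f u p} h ht₀₁ hzm hforce {N} R {t} hN ht hY => ?_⟩
  have hU : UniqueDiffOn ℝ (Icc t₀ t₁) := uniqueDiffOn_Icc ht₀₁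
  have hut : IsSmooth (u t) := h.smooth_velocity.isSmooth_slice ht
  -- the modewise energy identity, in the lattice form `-(κ x) a² - r + s`
  have hmode : ∀ k : d → ℤ,
      (inner ℂ (mFourierCoeff (EuclideanSpace.complexify ∘ timeDerivWithin (Icc t₀ t₁) u t) k)
        (mFourierCoeff (EuclideanSpace.complexify ∘ u t) k)).re =
      -((4 * Real.pi ^ 2 * ν) * freqNormSq k) * ‖mFourierCoeff (EuclideanSpace.complexify ∘ u t) k‖ ^ 2 -
        (inner ℂ (mFourierCoeff (EuclideanSpace.complexify ∘ Torus.convect (u t) (u t)) k)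
          (mFourierCoeff (EuclideanSpace.complexify ∘ u t) k)).re +
        (inner ℂ (mFourierCoeff (EuclideanSpace.complexify ∘ f t) k)
          (mFourierCoeff (EuclideanSpace.complexify ∘ u t) k)).re := fun k => by
    rw [h.re_inner_mFourierCoeff_timeDerivWithin hU ht k]
    ring
  simp only [hmode]
  refine hG R (fun k => norm_nonneg _) ?_ ?_ (sub_nonneg.2 ht.1) (sub_le_sub_right ht.2 _) hN
    (fun k => norm_mFourierCoeff_convect_le hut hut k)
    (fun k => (Complex.abs_re_le_norm _).trans (norm_inner_le_norm _ _))
    (fun k => (Complex.abs_re_le_norm _).trans (norm_inner_le_norm _ _)) (hforce t ht R) hY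
  · rw [mFourierCoeff_complexify_zero_of_hasZeroMean hut.integrable (hzm t ht), norm_zero]
  · have h1 := (summable_weight_mul_freqNormSq_sq_mul hut (w := fun _ => (1 : ℝ)) (W := 1)
      (fun _ => zero_le_one) (fun _ => le_rfl)).1
    simpa only [one_mul] using h1

end Solution

end NSGevrey

end Literature.Analysis.FluidPDE
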